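import Literature.Claims.NS.Washburn2026
import Literature.Analysis.FluidPDE.BurgersVortexLayerSteady
import HarnessLib

/-!
# C159 `Washburn2026` — tilted Burgers layers in the typed class `IsAE` (I): the layer,
# `|∇ξ| ≥ κ/10` across it, and kernel refutations of Steps 5, 6, 8 (literal)

Companion to `Theorems/SoloRefuteWashburn2026.lean` (`not_Theorem75_const`, the §8 form of Step 8).
For `ν = 1` and every `κ > 0` the steady tilted Burgers layer
`W7 κ (t, x) = (−2κ²x₀, V_κ(x₀), 2κ²x₂ + (3/5)x₀)`, `V_κ'(s) = (4/5)e^{−(κs)²}` (Burgers' 1948 layer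
of strain `2κ²`, unit viscosity, plus the compatible uniform shear `(3/5)x₀ e₃`, same pressure) lies in
`IsAE 1`: `ω = (0, −3/5, (4/5)e^{−(κx₀)²})`, `ρ = |ω| ∈ [3/5, 1]`, `ρ(0) = 1`, and the direction
`ξ = ω/ρ` turns at rate `|∇ξ| ≥ κ/10` on the slab `x₀ ∈ [1/(4κ), 1/(2κ)]`. Letting `κ → ∞` refutes
`Theorem74_GradBound` (Step 5, Thm 7.4 p.9 l.54–64) and `Step1_75_Transfer` (Step 6, Thm 7.5 proof
Step 1 p.9 l.69–75); `κ = 1` refutes `Theorem75_DirectionConstancy` (Step 8 literal, Thm 7.5 p.9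
l.65–66). Part II `SoloRefuteWashburn2026TiltedCoherence` refutes the integral faces (Steps 2, 4);
part III `SoloRefuteWashburn2026TiltedSerrin` Lemma 3.5's universal vorticity-gradient bound.
WHAT THIS IS NOT: not a claim about NS regularity or blow-up; not a claim about any author beyond the
typed locator.
-/

set_option linter.dupNamespace false
noncomputable section
open Real Set Function InnerProductSpace MeasureTheory
open scoped RealInnerProductSpace ContDiff Topology ENNReal Laplacian

namespace Summit.NavierStokesRegularity.NavierStokesRegularity.Theorems.Washburn2026Tilted
open Literature.Analysis.FluidPDE Literature.Analysis.FluidPDE.StrainedShear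
open Literature.Claims.NS.Washburn2026 (E3 rho xi gradXi Eomega IsAE Cor53_Coherence Prop72_BelowStruwe
  Theorem74_GradBound Step1_75_Transfer Theorem75_DirectionConstancy)

/-! ## Steady Navier–Stokes plus a compatible linear field -/

/-- `e₃ = (0, 0, 1)`. [folklore] -/
def e3 : E3 := EuclideanSpace.single 2 1

/-- The Laplacian of a linear map vanishes. [folklore] -/
theorem laplacian_clm (T : E3 →L[ℝ] E3) (x : E3) : Δ (⇑T) x = 0 := by
  rw [laplacian_eq_sum_fderiv_fderiv (stdOrthonormalBasis ℝ E3) T.contDiff x]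
  refine Finset.sum_eq_zero fun i _ => ?_
  have h : (fun y => fderiv ℝ (⇑T) y (stdOrthonormalBasis ℝ E3 i)) =
      fun _ => T (stdOrthonormalBasis ℝ E3 i) := by
    funext y; rw [T.fderiv]
  rw [h, fderiv_fun_const, Pi.zero_apply, _root_.zero_apply]

/-- **Superposing a compatible linear field.** If `(u, p)` is a steady classical NS solution and the
trace-free linear `T` has `Du(x)[Tx] + T(u x) + T(Tx) = 0`, then `(u + T, p)` is one too (`ΔT = 0`). [folklore] -/
theorem steady_add_clm {ν : ℝ} {u : E3 → E3} {p : E3 → ℝ} (h : IsSteadyClassicalNS ν 0 u p)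
    (T : E3 →L[ℝ] E3) (hT : ∀ x, fderiv ℝ u x (T x) + T (u x) + T (T x) = 0)
    (htr : LinearMap.trace ℝ E3 (T : E3 →ₗ[ℝ] E3) = 0) :
    IsSteadyClassicalNS ν 0 (u + ⇑T) p where
  smooth_velocity := h.smooth_velocity.add T.contDiff
  smooth_pressure := h.smooth_pressure
  momentum x := by
    have hu : DifferentiableAt ℝ u x := h.smooth_velocity.differentiable (by simp) x
    have hD : fderiv ℝ (u + ⇑T) x = fderiv ℝ u x + T := by
      rw [fderiv_add hu T.differentiableAt, T.fderiv]
    have hlap : Δ (u + ⇑T) x = Δ u x := by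
      rw [ContDiffAt.laplacian_add (h.smooth_velocity.of_le (by norm_cast)).contDiffAt
        (T.contDiff.of_le le_top).contDiffAt, laplacian_clm, add_zero]
    have hm := h.momentum x
    rw [convect_apply] at hm
    have key : (fderiv ℝ u x + T) ((u + ⇑T) x) =
        fderiv ℝ u x (u x) + (fderiv ℝ u x (T x) + T (u x) + T (T x)) := by
      simp only [Pi.add_apply, _root_.add_apply, map_add]; abel
    rw [convect_apply, hD, hlap, key, hT x, add_zero, hm]
  divFree x := by
    have hu : DifferentiableAt ℝ u x := h.smooth_velocity.differentiable (by simp) x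
    have h0 := h.divFree x
    unfold VectorCalculus.divergence at h0 ⊢
    rw [fderiv_add hu T.differentiableAt, T.fderiv, ContinuousLinearMap.toLinearMap_add, map_add, h0, htr,
      add_zero]

/-- The tilt `T_c x = (c x₀) e₃`. [folklore] -/
def tiltL (c : ℝ) : E3 →L[ℝ] E3 :=
  (c • (EuclideanSpace.proj (0 : Fin 3) : E3 →L[ℝ] ℝ)).smulRight e3

/-- `T_c x = (c x₀) e₃`. [folklore] -/
@[simp] theorem tiltL_apply (c : ℝ) (x : E3) : tiltL c x = (c * x 0) • e3 := by
  simp [tiltL]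

/-- The tilt is trace-free. [folklore] -/
theorem trace_tiltL (c : ℝ) : LinearMap.trace ℝ E3 (tiltL c : E3 →ₗ[ℝ] E3) = 0 := by
  rw [LinearMap.trace_eq_sum_inner _ (EuclideanSpace.basisFun (Fin 3) ℝ)]
  simp [Fin.sum_univ_three, e3, EuclideanSpace.inner_single_left]

/-! ## The tilted Burgers layers `W7 κ` (`ν = 1`, strain rate `2κ²`, jump `(4/5)√π/κ`, tilt `3/5`) -/

/-- The velocity jump `ΔU = (4/5)√π/κ`, normalising `max |ω| = 1`. [folklore] -/
def dU (κ : ℝ) : ℝ := 4 / 5 * Real.sqrt Real.pi / κ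

/-- The slice `x ↦ W7 κ (t, x)`: Burgers layer plus tilt. [folklore] -/
def slice (κ : ℝ) : E3 → E3 := burgersLayer (2 * κ ^ 2) 1 (dU κ) + ⇑(tiltL (3 / 5))

/-- `W7 κ`, constant in time. [folklore] -/
def W7 (κ : ℝ) : ℝ → E3 → E3 := fun _ => slice κ

/-- The pressure of `W7 κ` (the pure strain pressure). [folklore] -/
def P7 (κ : ℝ) : ℝ → E3 → ℝ := fun _ => burgersLayerPressure (2 * κ ^ 2)

/-- The compatibility `Du[Tx] + T(u x) + T(Tx) = 0` for the Burgers layer and the tilt. [folklore] -/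
theorem compat (γ ν ΔU c : ℝ) (x : E3) :
    fderiv ℝ (burgersLayer γ ν ΔU) x (tiltL c x) + tiltL c (burgersLayer γ ν ΔU x) +
      tiltL c (tiltL c x) = 0 := by
  have hV := hasDerivAt_burgersLayerProfile' γ ν ΔU
  have hdU : DifferentiableAt ℝ (planeStrain γ) x :=
    (hasFDerivAt_linearStrain _ _ _ x).differentiableAt
  have hU : fderiv ℝ (planeStrain γ) x = planeStrainL γ := (hasFDerivAt_linearStrain _ _ _ x).fderiv
  have hD : fderiv ℝ (burgersLayer γ ν ΔU) x =
      planeStrainL γ + fderiv ℝ (shear (burgersLayerProfile γ ν ΔU)) x := by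
    rw [burgersLayer, burgersLayerVelocity_eq_shear,
      fderiv_add hdU (hasFDerivAt_shear hV x).differentiableAt, hU]
  rw [hD]
  ext i
  fin_cases i
  · simp [fderiv_shear_apply hV, burgersLayer, burgersLayerVelocity, planeStrain, linearStrain, e3]
  · simp [fderiv_shear_apply hV, burgersLayer, burgersLayerVelocity, planeStrain, linearStrain, e3]
  · simp [fderiv_shear_apply hV, burgersLayer, burgersLayerVelocity, planeStrain, linearStrain, e3]
    ring

/-- **`W7 κ` is an exact steady Navier–Stokes solution** (`ν = 1`). [folklore] -/
theorem slice_steady (κ : ℝ) : IsSteadyClassicalNS 1 0 (slice κ) (burgersLayerPressure (2 * κ ^ 2)) :=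
  steady_add_clm (burgersLayer_isSteadyClassicalNS (2 * κ ^ 2) 1 (dU κ)) (tiltL (3 / 5))
    (compat _ _ _ _) (trace_tiltL _)

/-- `W7 κ` solves Navier–Stokes classically on `ℝ³ × (−∞, 0]`. [folklore] -/
theorem W7_sol (κ : ℝ) : IsClassicalNSSolutionOn (Iic 0) 1 0 (W7 κ) (P7 κ) :=
  (isSteadyClassicalNS_iff_const.1 (slice_steady κ)).mono (subset_univ _) (uniqueDiffOn_Iic 0)

/-! ## Vorticity `ω = (0, −3/5, g(x₀))`, its size `ρ = √q` and membership in `IsAE 1` -/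

/-- The Gaussian `g κ s = (4/5) e^{−(κs)²} = V_κ'(s)`. [folklore] -/
def g (κ s : ℝ) : ℝ := 4 / 5 * Real.exp (-(κ * s) ^ 2)

/-- `g' = −2κ² s g`. [folklore] -/
def g' (κ s : ℝ) : ℝ := -(2 * κ ^ 2 * s) * g κ s

/-- `V_κ' = g κ` (`κ > 0`). [folklore] -/
theorem profileD_eq {κ : ℝ} (hκ : 0 < κ) (s : ℝ) :
    burgersLayerProfileD (2 * κ ^ 2) 1 (dU κ) s = g κ s := by
  have hpi : Real.sqrt Real.pi ≠ 0 := (Real.sqrt_pos.2 Real.pi_pos).ne'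
  rw [burgersLayerProfileD, burgersLayerRate, show 2 * κ ^ 2 / (2 * 1) = κ ^ 2 by ring,
    Real.sqrt_sq hκ.le, dU, g]
  field_simp

/-- `0 < g ≤ 4/5`. [folklore] -/
theorem g_bounds (κ s : ℝ) : 0 < g κ s ∧ g κ s ≤ 4 / 5 := by
  have := Real.exp_le_one_iff.2 (neg_nonpos.2 (sq_nonneg (κ * s)))
  exact ⟨by unfold g; positivity, by unfold g; linarith⟩

/-- `g ≥ 3/5` on `0 ≤ s ≤ 1/(2κ)` (`e^{−1/4} ≥ 3/4`). [folklore] -/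
theorem g_ge {κ s : ℝ} (hκ : 0 < κ) (hs0 : 0 ≤ s) (hs : s ≤ 1 / (2 * κ)) : 3 / 5 ≤ g κ s := by
  have hks : κ * s ≤ 1 / 2 := by
    calc κ * s ≤ κ * (1 / (2 * κ)) := by gcongr
      _ = 1 / 2 := by field_simp
  have hks0 : 0 ≤ κ * s := by positivity
  have h1 : (κ * s) ^ 2 ≤ 1 / 4 := by nlinarith
  have hE := Real.add_one_le_exp (-(κ * s) ^ 2)
  unfold g
  linarith

/-- The vorticity vector across the layer: `vort κ s = −(3/5) e₂ + g κ s • e₃`. [folklore] -/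
def vort (κ s : ℝ) : E3 := -(3 / 5 : ℝ) • eOne + g κ s • e3

/-- `vort' = g' • e₃`. [folklore] -/
def vort' (κ s : ℝ) : E3 := g' κ s • e3

/-- `q = 9/25 + g² = |ω|²`. [folklore] -/
def q (κ s : ℝ) : ℝ := 9 / 25 + g κ s ^ 2

/-- `q' = 2 g g'`. [folklore] -/
def q' (κ s : ℝ) : ℝ := 2 * g κ s * g' κ s

/-- `9/25 < q ≤ 1`. [folklore] -/
theorem q_bounds (κ s : ℝ) : 9 / 25 < q κ s ∧ q κ s ≤ 1 := by
  obtain ⟨h0, h1⟩ := g_bounds κ s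
  unfold q
  constructor <;> nlinarith

/-- **The vorticity of `W7 κ`**: `ω(x) = (0, −3/5, (4/5)e^{−(κx₀)²})`. [folklore] -/
theorem curl_W7 {κ : ℝ} (hκ : 0 < κ) (t : ℝ) (x : E3) : curl (W7 κ t) x = vort κ (x 0) := by
  show curl (slice κ) x = _
  have hV := hasDerivAt_burgersLayerProfile' (2 * κ ^ 2) 1 (dU κ)
  have hdU : DifferentiableAt ℝ (planeStrain (2 * κ ^ 2)) x :=
    (hasFDerivAt_linearStrain _ _ _ x).differentiableAt
  have hU : fderiv ℝ (planeStrain (2 * κ ^ 2)) x = planeStrainL (2 * κ ^ 2) :=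
    (hasFDerivAt_linearStrain _ _ _ x).fderiv
  have hdB : DifferentiableAt ℝ (burgersLayer (2 * κ ^ 2) 1 (dU κ)) x :=
    (contDiff_burgersLayer _ _ _).differentiable (by simp) x
  have hD : fderiv ℝ (slice κ) x = planeStrainL (2 * κ ^ 2) +
      fderiv ℝ (shear (burgersLayerProfile (2 * κ ^ 2) 1 (dU κ))) x + tiltL (3 / 5) := by
    rw [slice, fderiv_add hdB (tiltL (3 / 5)).differentiableAt, (tiltL (3 / 5)).fderiv, burgersLayer,
      burgersLayerVelocity_eq_shear, fderiv_add hdU (hasFDerivAt_shear hV x).differentiableAt, hU]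
  ext i
  fin_cases i <;> simp [curl, hD, fderiv_shear_apply hV, profileD_eq hκ, linearStrain, eOne, e3, vort]

/-- `|vort| = √q`. [folklore] -/
theorem norm_vort (κ s : ℝ) : ‖vort κ s‖ = Real.sqrt (q κ s) := by
  rw [EuclideanSpace.norm_eq, q]
  congr 1
  simp [vort, Fin.sum_univ_three, eOne, e3]
  norm_num

/-- `ρ = √q(x₀)` for `W7 κ`. [folklore] -/
theorem rho_W7 {κ : ℝ} (hκ : 0 < κ) (t : ℝ) (x : E3) : rho (W7 κ) t x = Real.sqrt (q κ (x 0)) := by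
  unfold rho
  rw [curl_W7 hκ, norm_vort]

/-- `3/5 ≤ ρ`. [folklore] -/
theorem rho_ge {κ : ℝ} (hκ : 0 < κ) (t : ℝ) (x : E3) : 3 / 5 ≤ rho (W7 κ) t x := by
  rw [rho_W7 hκ, show (3 / 5 : ℝ) = Real.sqrt ((3 / 5) ^ 2) by rw [Real.sqrt_sq (by norm_num)]]
  exact Real.sqrt_le_sqrt (by nlinarith [(q_bounds κ (x 0)).1])

/-- `0 < ρ`. [folklore] -/
theorem rho_pos {κ : ℝ} (hκ : 0 < κ) (t : ℝ) (x : E3) : 0 < rho (W7 κ) t x :=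
  lt_of_lt_of_le (by norm_num) (rho_ge hκ t x)

/-- `ρ ≤ 1`. [folklore] -/
theorem rho_le_one {κ : ℝ} (hκ : 0 < κ) (t : ℝ) (x : E3) : rho (W7 κ) t x ≤ 1 := by
  rw [rho_W7 hκ, ← Real.sqrt_one]
  exact Real.sqrt_le_sqrt (q_bounds κ (x 0)).2

/-- `ρ(0) = 1`. [folklore] -/
theorem rho_origin {κ : ℝ} (hκ : 0 < κ) (t : ℝ) : rho (W7 κ) t 0 = 1 := by
  rw [rho_W7 hκ]
  simp [q, g]
  norm_num

/-- **`W7 κ ∈ IsAE 1`** (`κ > 0`): the typed running-max class contains the tilted layers.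
[cite: Washburn2026, Lemma 3.4 p.5 l.38–59; Lemma 3.6 p.5 l.63–73] -/
theorem isAE_W7 {κ : ℝ} (hκ : 0 < κ) : IsAE 1 (W7 κ) (P7 κ) where
  classical := W7_sol κ
  smooth _ _ := (slice_steady κ).smooth_velocity
  vort_le t _ x := rho_le_one hκ t x
  origin := rho_origin hκ 0
  sup_one t _ ε hε := ⟨0, by rw [rho_origin hκ t]; linarith⟩

/-! ## The direction `ξ = ω/ρ` and its gradient across the layer -/

/-- `r = 1/√q`. [folklore] -/
def r (κ s : ℝ) : ℝ := (Real.sqrt (q κ s))⁻¹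

/-- `r' = −(q'/(2√q))/√q²`. [folklore] -/
def r' (κ s : ℝ) : ℝ := -(q' κ s / (2 * Real.sqrt (q κ s))) / Real.sqrt (q κ s) ^ 2

/-- `ξ` across the layer: `Xi κ s = r • vort`. [folklore] -/
def Xi (κ s : ℝ) : E3 := r κ s • vort κ s

/-- `Xi' = r • vort' + r' • vort`. [folklore] -/
def Xi' (κ s : ℝ) : E3 := r κ s • vort' κ s + r' κ s • vort κ s

/-- `ξ(x) = Xi κ (x₀)` for `W7 κ`. [folklore] -/
theorem xi_W7 {κ : ℝ} (hκ : 0 < κ) (t : ℝ) : xi (W7 κ) t = fun x => Xi κ (x 0) := by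
  funext x
  unfold xi
  rw [rho_W7 hκ, curl_W7 hκ]
  rfl

/-- `HasDerivAt g g'`. [folklore] -/
theorem hasDerivAt_g (κ s : ℝ) : HasDerivAt (g κ) (g' κ s) s := by
  have hlin : HasDerivAt (fun u : ℝ => κ * u) κ s := by simpa using (hasDerivAt_id s).const_mul κ
  have hsq : HasDerivAt (fun u : ℝ => -(κ * u) ^ 2) (-(2 * (κ * s) * κ)) s := by
    simpa using (hlin.fun_pow 2).fun_neg
  refine (hsq.exp.const_mul (4 / 5 : ℝ)).congr_deriv ?_
  simp only [g', g]
  ring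

/-- `HasDerivAt q q'`. [folklore] -/
theorem hasDerivAt_q (κ s : ℝ) : HasDerivAt (q κ) (q' κ s) s := by
  refine (((hasDerivAt_g κ s).fun_pow 2).const_add (9 / 25 : ℝ)).congr_deriv ?_
  rw [q']
  norm_num

/-- `HasDerivAt r r'`. [folklore] -/
theorem hasDerivAt_r (κ s : ℝ) : HasDerivAt (r κ) (r' κ s) s := by
  have hq : 0 < q κ s := by linarith [(q_bounds κ s).1]
  exact ((hasDerivAt_q κ s).sqrt hq.ne').inv (Real.sqrt_pos.2 hq).ne'

/-- `HasDerivAt vort vort'`. [folklore] -/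
theorem hasDerivAt_vort (κ s : ℝ) : HasDerivAt (vort κ) (vort' κ s) s :=
  ((hasDerivAt_g κ s).smul_const e3).const_add (-(3 / 5 : ℝ) • eOne)

/-- `HasDerivAt Xi Xi'`. [folklore] -/
theorem hasDerivAt_Xi (κ s : ℝ) : HasDerivAt (Xi κ) (Xi' κ s) s :=
  (hasDerivAt_r κ s).smul (hasDerivAt_vort κ s)

/-- **The gradient of `ξ` for `W7 κ`**: `∇ξ(x) h = h₀ Xi'(x₀)`. [folklore] -/
theorem hasFDerivAt_xi {κ : ℝ} (hκ : 0 < κ) (t : ℝ) (x : E3) :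
    HasFDerivAt (xi (W7 κ) t) ((ContinuousLinearMap.smulRight (1 : ℝ →L[ℝ] ℝ) (Xi' κ (x 0))).comp
      (EuclideanSpace.proj (0 : Fin 3))) x := by
  rw [xi_W7 hκ]
  exact (hasDerivAt_Xi κ (x 0)).hasFDerivAt.comp x
    (EuclideanSpace.proj (0 : Fin 3) : E3 →L[ℝ] ℝ).hasFDerivAt

/-- `∇ξ(x) e₁ = Xi'(x₀)`. [folklore] -/
theorem gradXi_apply_e0 {κ : ℝ} (hκ : 0 < κ) (t : ℝ) (x : E3) :
    gradXi (W7 κ) t x (EuclideanSpace.single 0 1) = Xi' κ (x 0) := by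
  rw [gradXi, (hasFDerivAt_xi hκ t x).fderiv]
  simp

/-- The `e₂`-component of `Xi'` is `−(3/5) r'`. [folklore] -/
theorem Xi'_apply_one (κ s : ℝ) : Xi' κ s 1 = -(3 / 5) * r' κ s := by
  simp [Xi', vort, vort', eOne, e3]
  ring

/-- **The layer turns the direction at rate `≍ κ`**: `(3/5) r' ≥ κ/10` on `s ∈ [1/(4κ), 1/(2κ)]`.
[folklore] -/
theorem key {κ s : ℝ} (hκ : 0 < κ) (hs1 : 1 / (4 * κ) ≤ s) (hs2 : s ≤ 1 / (2 * κ)) :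
    κ / 10 ≤ 3 / 5 * r' κ s := by
  have hs0 : 0 < s := lt_of_lt_of_le (by positivity) hs1
  have hG : 3 / 5 ≤ g κ s := g_ge hκ hs0.le hs2
  obtain ⟨hQlo, hQhi⟩ := q_bounds κ s
  have hQpos : 0 < q κ s := by linarith
  have hS2 : Real.sqrt (q κ s) ^ 2 = q κ s := Real.sq_sqrt hQpos.le
  have hSpos : 0 < Real.sqrt (q κ s) := Real.sqrt_pos.2 hQpos
  have hSne : Real.sqrt (q κ s) ≠ 0 := hSpos.ne'
  have hQne : q κ s ≠ 0 := hQpos.ne'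
  have hS1 : Real.sqrt (q κ s) ≤ 1 := by
    rw [← Real.sqrt_one]
    exact Real.sqrt_le_sqrt hQhi
  have hr' : 3 / 5 * r' κ s = (6 / 5 * κ ^ 2 * s * g κ s ^ 2) / (Real.sqrt (q κ s) * q κ s) := by
    rw [r', hS2, q', g']
    field_simp
    ring
  rw [hr', le_div_iff₀ (by positivity)]
  have h1 : κ / 4 ≤ κ ^ 2 * s := by
    have h : κ ^ 2 * (1 / (4 * κ)) ≤ κ ^ 2 * s := by gcongr
    calc κ / 4 = κ ^ 2 * (1 / (4 * κ)) := by field_simp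
      _ ≤ κ ^ 2 * s := h
  have h2 : 9 / 25 ≤ g κ s ^ 2 := by nlinarith
  have h12 : κ / 4 * (9 / 25) ≤ κ ^ 2 * s * g κ s ^ 2 :=
    mul_le_mul h1 h2 (by norm_num) (by positivity)
  have hSQ : κ * (Real.sqrt (q κ s) * q κ s) ≤ κ * 1 :=
    mul_le_mul_of_nonneg_left (by nlinarith) hκ.le
  nlinarith

/-- **`|∇ξ| ≥ κ/10` on the slab `x₀ ∈ [1/(4κ), 1/(2κ)]`** for `W7 κ`. [folklore] -/
theorem gradXi_ge {κ : ℝ} (hκ : 0 < κ) (t : ℝ) {x : E3} (h1 : 1 / (4 * κ) ≤ x 0)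
    (h2 : x 0 ≤ 1 / (2 * κ)) : κ / 10 ≤ ‖gradXi (W7 κ) t x‖ := by
  calc κ / 10 ≤ 3 / 5 * r' κ (x 0) := key hκ h1 h2
    _ ≤ |Xi' κ (x 0) 1| := by
        rw [Xi'_apply_one, neg_mul, abs_neg]
        exact le_abs_self _
    _ = ‖Xi' κ (x 0) 1‖ := (Real.norm_eq_abs _).symm
    _ ≤ ‖Xi' κ (x 0)‖ := PiLp.norm_apply_le _ _
    _ = ‖gradXi (W7 κ) t x (EuclideanSpace.single 0 1)‖ := by rw [gradXi_apply_e0 hκ]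
    _ ≤ ‖gradXi (W7 κ) t x‖ * ‖(EuclideanSpace.single 0 1 : E3)‖ :=
        ContinuousLinearMap.le_opNorm _ _
    _ = ‖gradXi (W7 κ) t x‖ := by simp

/-- The point `x = (1/(2κ), 0, 0)` on the slab. [folklore] -/
def pt (κ : ℝ) : E3 := EuclideanSpace.single 0 (1 / (2 * κ))

/-- `|∇ξ(pt κ)| ≥ κ/10`. [folklore] -/
theorem gradXi_ge_pt {κ : ℝ} (hκ : 0 < κ) (t : ℝ) : κ / 10 ≤ ‖gradXi (W7 κ) t (pt κ)‖ := by
  have h0 : pt κ 0 = 1 / (2 * κ) := by simp [pt]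
  have h1 : 1 / (4 * κ) ≤ 1 / (2 * κ) := one_div_le_one_div_of_le (by positivity) (by linarith)
  exact gradXi_ge hκ t (by rwa [h0]) (by rw [h0])

/-! ## Refutations of the pointwise faces: Steps 5, 6, 8 (literal) -/

/-- **Refutes Step 5 — Theorem 7.4 p.9 l.54–64** («|∇ξ^∞(z₁)| ≤ 2C_S C_Ser/η whenever ρ^∞(z₁) ≥ η», one
constant for the class): on `W7 κ`, `ρ ≥ 3/5` while `|∇ξ(pt κ)| ≥ κ/10 → ∞`. [cite: Washburn2026, Thm 7.4 p.9] -/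
theorem not_Theorem74_GradBound : ¬ Theorem74_GradBound := by
  intro h
  obtain ⟨C, hC⟩ := h 1 one_pos
  set κ : ℝ := 20 * |C| + 1 with hκ
  have hκ0 : 0 < κ := by positivity
  have h1 := hC (W7 κ) (P7 κ) (isAE_W7 hκ0) (3 / 5) (by norm_num) 0 le_rfl (pt κ) (rho_ge hκ0 0 _)
  have h2 := gradXi_ge_pt hκ0 0
  have h3 : C / (3 / 5) = 5 / 3 * C := by ring
  rw [h3] at h1
  have h4 := le_abs_self C
  linarith

/-- **Refutes Step 6 — Theorem 7.5 proof Step 1 p.9 l.69–75** («a universal constant C_∞ < ∞ with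
|∇ξ^∞| ≤ C_∞ everywhere»): `|∇ξ(pt κ)| ≥ κ/10 → ∞` on `W7 κ ∈ IsAE 1`. [cite: Washburn2026, p.9 l.69–75] -/
theorem not_Step1_75_Transfer : ¬ Step1_75_Transfer := by
  intro h
  obtain ⟨C, hC⟩ := h 1 one_pos
  set κ : ℝ := 10 * |C| + 1 with hκ
  have hκ0 : 0 < κ := by positivity
  have h1 := hC (W7 κ) (P7 κ) (isAE_W7 hκ0) 0 le_rfl (pt κ) (rho_pos hκ0 0 _)
  have h2 := gradXi_ge_pt hκ0 0
  have h4 := le_abs_self C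
  linarith

/-- **Refutes Step 8 as printed — Theorem 7.5 p.9 l.65–66** («∇ξ^∞ ≡ 0 on R³ × (−∞, 0]», on `{ρ > 0}`):
`W7 1 ∈ IsAE 1` has `ρ > 0` everywhere and `∇ξ(pt 1) ≠ 0`. [cite: Washburn2026, Thm 7.5 p.9 l.65–66] -/
theorem not_Theorem75_DirectionConstancy : ¬ Theorem75_DirectionConstancy := by
  intro h
  have h1 := h 1 one_pos (W7 1) (P7 1) (isAE_W7 one_pos) 0 le_rfl (pt 1) (rho_pos one_pos 0 _)
  have h2 := gradXi_ge_pt one_pos 0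
  rw [h1, norm_zero] at h2
  linarith

end Summit.NavierStokesRegularity.NavierStokesRegularity.Theorems.Washburn2026Tilted
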